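/-
Copyright (c) 2026 The decomp-a2c cell. All rights reserved.
Released under Apache 2.0 license as described in the file LICENSE.
-/
import Summits.AtomisticToContinuum.Crystallization.Theorems.ChartedZeroExcessLayeredLatticeLiouvilleWJ

/-!
# ChartedZeroExcessLayeredLatticeLiouville — part WK «GapGradient»: the in-plane GRADIENT of the vertical gap increment of a harmonic field is
  `≲ √(E/#ball)/n` POINTWISE (decomp-a2c-lens-2, g58; helper of stmt-AtomisticToContinuum-26636, leaf (LD′) `ModalLipschitzZ`; brick (4a)
  `ModalLipschitzAt`, vertical half (4a⊥), step (WK) of the g58 plan)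

★ `gap_gradient_sq_le`: for a field `ψ` harmonic on `idxBall x₀ n` (`n ≥ 256(ϱ/c+2)`, `n³ ≥ 2²⁵ ϱ/c`), an in-plane step `E` (`E.2 = 0`,
`idxNorm E ≤ 1`) and every site `(γ, k)` of the half ball,
  `n² · #(idxBall x₀ n) · ‖D_E ψ(γ, k+1) − D_E ψ(γ, k)‖² ≤ gradConst c κ₀ ε · E(ψ; idxBall x₀ n)`,
with a constant `gradConst` that does NOT depend on the interaction range `ϱ`.

PROOF.  The vertical increment `g = D₃ D_E ψ` is evaluated at the centre of the layer `k` of the cube of half-width `R = ⌊n/64⌋₊` about `(γ,k)` by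
part WJ's layer sup bound (`(2R+1)² ‖g‖² ≤ 4Σ‖g‖² + 4(2R+1)2R (Σ‖D₁g‖² + Σ‖D₂g‖²) + 4((2R+1)2R)² Σ‖D₁D₂g‖²`); after commuting differences (WE
`latDiff_latDiff_comm`) the four layer sums are part WI's single-gap sums of the harmonic fields `D_Eψ, D₁D_Eψ, D₂D_Eψ, D₁D₂D_Eψ` on
`idxBall (γ,k) (n/4)`, each `≤ 4M² · brk · (energy)` with `n · brk ≤ gradBrk` (`bracket_mul_le`: the long window `2R+1 ≍ n` makes every term of WI's
bracket `O(1/n)`), and part WA's iterated Caccioppoli bounds `energy_iterate₁/₂/₃_le` give the energies `2¹⁰K E/n², 2²⁰K² E/n⁴, 2³⁰K³ E/n⁶`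
(`K = 54 kernelConst/κ₀`).  The pure-algebra bookkeeping is `gap_algebra`; `#(idxBall x₀ n) ≤ 27 n³` finishes.
-/

namespace Summit.AtomisticToContinuum.Crystallization.Theorems.ChartedZeroExcessLayeredLatticeLiouville

open Summit.AtomisticToContinuum.Crystallization.Theorems.ChartedPlanarOrderRigidityDoor (E3)
open Finset
open scoped InnerProductSpace RealInnerProductSpace BigOperators

noncomputable section GapGradient

variable {c : ℝ} {a b : E3} {w : ℤ → E3}

/-! ### WK.1  Constants -/

/-- `n ×` WI's bracket at the long window: `576 (196F)² + (108F)² · lipConst + divConst + stabConst²`. -/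
def gradBrk (c κ₀ ε : ℝ) : ℝ :=
  576 * (196 * kernelConst c) ^ 2 + (108 * kernelConst c) ^ 2 * lipConst c κ₀ + divConst c κ₀ + stabConst c (κ₀ - ε / 2) ^ 2

/-- the constant of the pointwise gap-gradient bound `gap_gradient_sq_le` (no dependence on `ϱ`). -/
def gradConst (c κ₀ ε : ℝ) : ℝ :=
  27 * (modeConst c (κ₀ - ε / 2) ^ 2 * gradBrk c κ₀ ε *
    (2 ^ 26 * (54 * kernelConst c / κ₀) + 2 ^ 29 * (54 * kernelConst c / κ₀) ^ 2 + 2 ^ 30 * (54 * kernelConst c / κ₀) ^ 3))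

/-! ### WK.2  Counting and the bracket at the long window -/

/-- an index ball of radius `m ≥ 0` has at least `m³` sites. [formal bookkeeping] -/
theorem cube_le_ncard_idxBall (x₁ : Cell 2 × ℤ) {m : ℝ} (hm : 0 ≤ m) : m ^ 3 ≤ ((idxBall x₁ m).ncard : ℝ) := by
  rw [← coe_idxBallF, Set.ncard_coe_finset, card_idxBallF_eq x₁ hm]
  push_cast
  have h := (Nat.lt_floor_add_one m).le
  exact pow_le_pow_left₀ hm (by linarith [(Nat.cast_nonneg ⌊m⌋₊ : (0 : ℝ) ≤ ⌊m⌋₊)]) 3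

/-- an index ball of radius `n ≥ 1` has at most `27 n³` sites. [formal bookkeeping] -/
theorem ncard_idxBall_le_cube (x₀ : Cell 2 × ℤ) {n : ℝ} (hn : 1 ≤ n) : ((idxBall x₀ n).ncard : ℝ) ≤ 27 * n ^ 3 := by
  have h := ncard_idxBall_le_box x₀ hn
  push_cast at h
  have hf : (⌊n⌋₊ : ℝ) ≤ n := Nat.floor_le (by linarith)
  have hf0 : (0 : ℝ) ≤ ⌊n⌋₊ := Nat.cast_nonneg _
  have e1 : 2 * (⌊n⌋₊ : ℝ) * (2 * ⌊n⌋₊ + 1) ^ 2 ≤ 2 * n * (3 * n) ^ 2 :=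
    mul_le_mul (by linarith) (pow_le_pow_left₀ (by positivity) (by linarith) 2) (by positivity) (by positivity)
  linarith

/-- ★ the bracket of WI's `single_gap_sq_le` at the LONG window `2R+1 ∈ [n/64, n/16]` on the ball of radius `n/4` is `≤ gradBrk / n`:
`n · ((2R+1)⁻¹ 9(196F)² + 4 #L (108F)² lip/#ball + (2R+1) divConst/(n/4)² + stab² ((R+2)⁻²)² 2⌊ϱ/c⌋₊) ≤ gradBrk` (`#L ≤ (2R+1)²`,
`#ball ≥ (n/4)³`, `n³ ≥ 2²⁵ ϱ/c`). [this file, g58] -/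
theorem bracket_mul_le (c κ₀ ε : ℝ) {ϱ n Lc Nc : ℝ} {R : ℕ} (hϱc : 0 ≤ ϱ / c) (hn0 : 0 < n) (hR1 : n / 64 ≤ 2 * (R : ℝ) + 1)
    (hR2 : 2 * (R : ℝ) + 1 ≤ n / 16) (hR3 : n / 64 ≤ (R : ℝ) + 2) (hL : Lc ≤ (2 * (R : ℝ) + 1) ^ 2) (hNc0 : 0 < Nc)
    (hNc : (n / 4) ^ 3 ≤ Nc) (hn3 : 2 ^ 25 * (ϱ / c) ≤ n ^ 3) (hlip : 0 ≤ lipConst c κ₀) (hdC : 0 ≤ divConst c κ₀) :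
    n * ((2 * (R : ℝ) + 1)⁻¹ * (9 * (196 * kernelConst c) ^ 2) + 4 * Lc * (108 * kernelConst c) ^ 2 * lipConst c κ₀ / Nc +
        (2 * (R : ℝ) + 1) * divConst c κ₀ / (n / 4) ^ 2 + stabConst c (κ₀ - ε / 2) ^ 2 * ((((R : ℕ) : ℝ) + 2)⁻¹ ^ 2) ^ 2 * (2 * ⌊ϱ / c⌋₊)) ≤
      gradBrk c κ₀ ε := by
  have hn0' : n ≠ 0 := hn0.ne'
  have hR0 : (0 : ℝ) < 2 * (R : ℝ) + 1 := by positivity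
  have hst2 : 0 ≤ stabConst c (κ₀ - ε / 2) ^ 2 := sq_nonneg _
  have u1 : n * ((2 * (R : ℝ) + 1)⁻¹ * (9 * (196 * kernelConst c) ^ 2)) ≤ 576 * (196 * kernelConst c) ^ 2 := by
    have h : n * (2 * (R : ℝ) + 1)⁻¹ ≤ 64 := by
      rw [← div_eq_mul_inv, div_le_iff₀ hR0]
      linarith
    calc n * ((2 * (R : ℝ) + 1)⁻¹ * (9 * (196 * kernelConst c) ^ 2)) = n * (2 * (R : ℝ) + 1)⁻¹ * (9 * (196 * kernelConst c) ^ 2) := by ring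
      _ ≤ 64 * (9 * (196 * kernelConst c) ^ 2) := mul_le_mul_of_nonneg_right h (by positivity)
      _ = 576 * (196 * kernelConst c) ^ 2 := by ring
  have u2 : n * (4 * Lc * (108 * kernelConst c) ^ 2 * lipConst c κ₀ / Nc) ≤ (108 * kernelConst c) ^ 2 * lipConst c κ₀ := by
    have h : 4 * Lc * n ≤ Nc := by
      have h1 : 4 * Lc * n ≤ 4 * (2 * (R : ℝ) + 1) ^ 2 * n := mul_le_mul_of_nonneg_right (mul_le_mul_of_nonneg_left hL (by norm_num)) hn0.le
      have h2 : (2 * (R : ℝ) + 1) ^ 2 ≤ (n / 16) ^ 2 := pow_le_pow_left₀ hR0.le hR2 2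
      have h3 : 4 * (2 * (R : ℝ) + 1) ^ 2 * n ≤ 4 * (n / 16) ^ 2 * n := mul_le_mul_of_nonneg_right (mul_le_mul_of_nonneg_left h2 (by norm_num)) hn0.le
      have h4 : 4 * (n / 16) ^ 2 * n = (n / 4) ^ 3 := by ring
      linarith
    have h' : 4 * Lc * n / Nc ≤ 1 := (div_le_one hNc0).mpr h
    calc n * (4 * Lc * (108 * kernelConst c) ^ 2 * lipConst c κ₀ / Nc) = 4 * Lc * n / Nc * ((108 * kernelConst c) ^ 2 * lipConst c κ₀) := by ring
      _ ≤ 1 * ((108 * kernelConst c) ^ 2 * lipConst c κ₀) := mul_le_mul_of_nonneg_right h' (by positivity)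
      _ = (108 * kernelConst c) ^ 2 * lipConst c κ₀ := one_mul _
  have u3 : n * ((2 * (R : ℝ) + 1) * divConst c κ₀ / (n / 4) ^ 2) ≤ divConst c κ₀ := by
    have h : 16 * (2 * (R : ℝ) + 1) / n ≤ 16 * (n / 16) / n := div_le_div_of_nonneg_right (by linarith) hn0.le
    have h' : 16 * (n / 16) / n = 1 := by field_simp
    calc n * ((2 * (R : ℝ) + 1) * divConst c κ₀ / (n / 4) ^ 2) = 16 * (2 * (R : ℝ) + 1) / n * divConst c κ₀ := by field_simp; ring
      _ ≤ 16 * (n / 16) / n * divConst c κ₀ := mul_le_mul_of_nonneg_right h hdC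
      _ = divConst c κ₀ := by rw [h', one_mul]
  have u4 : n * (stabConst c (κ₀ - ε / 2) ^ 2 * ((((R : ℕ) : ℝ) + 2)⁻¹ ^ 2) ^ 2 * (2 * ⌊ϱ / c⌋₊)) ≤ stabConst c (κ₀ - ε / 2) ^ 2 := by
    have e4 : ((((R : ℕ) : ℝ) + 2)⁻¹ ^ 2) ^ 2 = ((((R : ℕ) : ℝ) + 2) ^ 4)⁻¹ := by
      rw [← pow_mul, inv_pow]
    have hR4 : (n / 64) ^ 4 ≤ (((R : ℕ) : ℝ) + 2) ^ 4 := pow_le_pow_left₀ (by positivity) hR3 4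
    have hinv : ((((R : ℕ) : ℝ) + 2) ^ 4)⁻¹ ≤ ((n / 64) ^ 4)⁻¹ := inv_anti₀ (by positivity) hR4
    have hr' : ((⌊ϱ / c⌋₊ : ℕ) : ℝ) ≤ ϱ / c := Nat.floor_le hϱc
    rw [e4]
    calc n * (stabConst c (κ₀ - ε / 2) ^ 2 * ((((R : ℕ) : ℝ) + 2) ^ 4)⁻¹ * (2 * ⌊ϱ / c⌋₊))
        = stabConst c (κ₀ - ε / 2) ^ 2 * (n * ((((R : ℕ) : ℝ) + 2) ^ 4)⁻¹ * (2 * ⌊ϱ / c⌋₊)) := by ring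
      _ ≤ stabConst c (κ₀ - ε / 2) ^ 2 * (n * ((n / 64) ^ 4)⁻¹ * (2 * (ϱ / c))) :=
          mul_le_mul_of_nonneg_left (mul_le_mul (mul_le_mul_of_nonneg_left hinv hn0.le) (by linarith) (by positivity) (by positivity)) hst2
      _ = stabConst c (κ₀ - ε / 2) ^ 2 * (2 ^ 25 * (ϱ / c) / n ^ 3) := by field_simp; ring
      _ ≤ stabConst c (κ₀ - ε / 2) ^ 2 * 1 := mul_le_mul_of_nonneg_left ((div_le_one (by positivity)).mpr hn3) hst2
      _ = stabConst c (κ₀ - ε / 2) ^ 2 := mul_one _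
  rw [mul_add, mul_add, mul_add, gradBrk]
  linarith

/-! ### WK.3  The algebra of the assembly -/

/-- ★ the pure-algebra bookkeeping of `gap_gradient_sq_le`: layer sup bound + four single-gap bounds + the bracket and energy bounds in product form
`⟹ n⁵ ‖g‖² ≤ M² K₁ (2²⁶K + 2²⁹K² + 2³⁰K³) E`. [this file, g58] -/
theorem gap_algebra {n R g2 S0 S1 S2 S12 E0 E1 E2 E12 Ebig M2 K K1 brk : ℝ} (hn0 : 0 < n) (hR0 : 0 ≤ R) (hR1 : n / 64 ≤ 2 * R + 1)
    (hR2 : 2 * R + 1 ≤ n / 16) (hg2 : 0 ≤ g2) (hS1 : 0 ≤ S1) (hS2 : 0 ≤ S2) (hS12 : 0 ≤ S12) (hE0 : 0 ≤ E0) (hE1 : 0 ≤ E1) (hE2 : 0 ≤ E2)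
    (hE12 : 0 ≤ E12) (hM2 : 0 ≤ M2) (hK1 : 0 ≤ K1) (hb : n * brk ≤ K1)
    (h0 : S0 ≤ 4 * M2 * brk * E0) (h1 : S1 ≤ 4 * M2 * brk * E1) (h2 : S2 ≤ 4 * M2 * brk * E2) (h12 : S12 ≤ 4 * M2 * brk * E12)
    (f0 : n ^ 2 * E0 ≤ 2 ^ 10 * K * Ebig) (f1 : n ^ 4 * E1 ≤ 2 ^ 20 * K ^ 2 * Ebig) (f2 : n ^ 4 * E2 ≤ 2 ^ 20 * K ^ 2 * Ebig)
    (f12 : n ^ 6 * E12 ≤ 2 ^ 30 * K ^ 3 * Ebig)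
    (hsup : (2 * R + 1) ^ 2 * g2 ≤ 4 * S0 + 4 * ((2 * R + 1) * (2 * R)) * S1 + 4 * ((2 * R + 1) * (2 * R)) * S2 + 4 * ((2 * R + 1) * (2 * R)) ^ 2 * S12) :
    n ^ 5 * g2 ≤ M2 * K1 * (2 ^ 26 * K + 2 ^ 29 * K ^ 2 + 2 ^ 30 * K ^ 3) * Ebig := by
  have v0 : n ^ 3 * S0 ≤ 2 ^ 12 * M2 * K1 * K * Ebig := by
    calc n ^ 3 * S0 ≤ n ^ 3 * (4 * M2 * brk * E0) := mul_le_mul_of_nonneg_left h0 (by positivity)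
      _ = 4 * M2 * ((n * brk) * (n ^ 2 * E0)) := by ring
      _ ≤ 4 * M2 * (K1 * (2 ^ 10 * K * Ebig)) := mul_le_mul_of_nonneg_left (mul_le_mul hb f0 (by positivity) hK1) (by positivity)
      _ = 2 ^ 12 * M2 * K1 * K * Ebig := by ring
  have v1 : n ^ 5 * S1 ≤ 2 ^ 22 * M2 * K1 * K ^ 2 * Ebig := by
    calc n ^ 5 * S1 ≤ n ^ 5 * (4 * M2 * brk * E1) := mul_le_mul_of_nonneg_left h1 (by positivity)
      _ = 4 * M2 * ((n * brk) * (n ^ 4 * E1)) := by ring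
      _ ≤ 4 * M2 * (K1 * (2 ^ 20 * K ^ 2 * Ebig)) := mul_le_mul_of_nonneg_left (mul_le_mul hb f1 (by positivity) hK1) (by positivity)
      _ = 2 ^ 22 * M2 * K1 * K ^ 2 * Ebig := by ring
  have v2 : n ^ 5 * S2 ≤ 2 ^ 22 * M2 * K1 * K ^ 2 * Ebig := by
    calc n ^ 5 * S2 ≤ n ^ 5 * (4 * M2 * brk * E2) := mul_le_mul_of_nonneg_left h2 (by positivity)
      _ = 4 * M2 * ((n * brk) * (n ^ 4 * E2)) := by ring
      _ ≤ 4 * M2 * (K1 * (2 ^ 20 * K ^ 2 * Ebig)) := mul_le_mul_of_nonneg_left (mul_le_mul hb f2 (by positivity) hK1) (by positivity)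
      _ = 2 ^ 22 * M2 * K1 * K ^ 2 * Ebig := by ring
  have v12 : n ^ 7 * S12 ≤ 2 ^ 32 * M2 * K1 * K ^ 3 * Ebig := by
    calc n ^ 7 * S12 ≤ n ^ 7 * (4 * M2 * brk * E12) := mul_le_mul_of_nonneg_left h12 (by positivity)
      _ = 4 * M2 * ((n * brk) * (n ^ 6 * E12)) := by ring
      _ ≤ 4 * M2 * (K1 * (2 ^ 30 * K ^ 3 * Ebig)) := mul_le_mul_of_nonneg_left (mul_le_mul hb f12 (by positivity) hK1) (by positivity)
      _ = 2 ^ 32 * M2 * K1 * K ^ 3 * Ebig := by ring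
  have hA0 : 0 ≤ (2 * R + 1) * (2 * R) := by positivity
  have hA : (2 * R + 1) * (2 * R) ≤ n ^ 2 / 256 := by nlinarith
  have hB : ((2 * R + 1) * (2 * R)) ^ 2 ≤ (n ^ 2 / 256) ^ 2 := pow_le_pow_left₀ hA0 hA 2
  have hRsq : n ^ 2 ≤ 2 ^ 12 * (2 * R + 1) ^ 2 := by
    have h := pow_le_pow_left₀ (by positivity) hR1 2
    linarith
  calc n ^ 5 * g2 = n ^ 3 * (n ^ 2 * g2) := by ring
    _ ≤ n ^ 3 * (2 ^ 12 * (2 * R + 1) ^ 2 * g2) := mul_le_mul_of_nonneg_left (mul_le_mul_of_nonneg_right hRsq hg2) (by positivity)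
    _ = 2 ^ 12 * n ^ 3 * ((2 * R + 1) ^ 2 * g2) := by ring
    _ ≤ 2 ^ 12 * n ^ 3 * (4 * S0 + 4 * ((2 * R + 1) * (2 * R)) * S1 + 4 * ((2 * R + 1) * (2 * R)) * S2 + 4 * ((2 * R + 1) * (2 * R)) ^ 2 * S12) :=
        mul_le_mul_of_nonneg_left hsup (by positivity)
    _ ≤ 2 ^ 12 * n ^ 3 * (4 * S0 + 4 * (n ^ 2 / 256) * S1 + 4 * (n ^ 2 / 256) * S2 + 4 * (n ^ 2 / 256) ^ 2 * S12) :=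
        mul_le_mul_of_nonneg_left (add_le_add (add_le_add (add_le_add le_rfl (mul_le_mul_of_nonneg_right (mul_le_mul_of_nonneg_left hA
          (by norm_num)) hS1)) (mul_le_mul_of_nonneg_right (mul_le_mul_of_nonneg_left hA (by norm_num)) hS2))
          (mul_le_mul_of_nonneg_right (mul_le_mul_of_nonneg_left hB (by norm_num)) hS12)) (by positivity)
    _ = 2 ^ 12 * (4 * (n ^ 3 * S0) + (1 / 64) * (n ^ 5 * S1) + (1 / 64) * (n ^ 5 * S2) + (1 / 2 ^ 14) * (n ^ 7 * S12)) := by ring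
    _ ≤ 2 ^ 12 * (4 * (2 ^ 12 * M2 * K1 * K * Ebig) + (1 / 64) * (2 ^ 22 * M2 * K1 * K ^ 2 * Ebig) + (1 / 64) * (2 ^ 22 * M2 * K1 * K ^ 2 * Ebig) +
          (1 / 2 ^ 14) * (2 ^ 32 * M2 * K1 * K ^ 3 * Ebig)) := by linarith
    _ = M2 * K1 * (2 ^ 26 * K + 2 ^ 29 * K ^ 2 + 2 ^ 30 * K ^ 3) * Ebig := by ring

/-! ### WK.4  ★ The pointwise gap-gradient bound -/

/-- ★ GAP GRADIENT (4a⊥, step WK): for `ψ` harmonic on `idxBall x₀ n`, an in-plane unit step `E` and every site `(γ,k)` of the half ball,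
`n² · #(idxBall x₀ n) · ‖D_Eψ(γ,k+1) − D_Eψ(γ,k)‖² ≤ gradConst · E(ψ; idxBall x₀ n)` — the in-plane gradient of the vertical gap increment is
`≲ √(E/#ball)/n` pointwise, with a `ϱ`-free constant (WJ layer sup + WI single gap ×4 + WA iterated Caccioppoli). [this file, g58] -/
theorem gap_gradient_sq_le (hc : 0 < c) (hL : IsLayeredCrystal c a b w) {κ₀ ε ϱ : ℝ} (hκ₀ : 0 < κ₀) (hϱ : 0 ≤ ϱ) (hε : ε < 2 * κ₀)
    (hK : CoerciveZ (layeredKernel a b w) κ₀)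
    (hT : ∀ φ : Cell 2 → ℤ → E3, HasFiniteSupport φ → Summable (tailFam ϱ a b w φ) ∧ ∑' x, tailFam ϱ a b w φ x ≤ ε * nnFormZ φ)
    (hP : ∀ E₀ : Cell 2 × ℤ, E₀.2 = 0 → (idxNorm E₀ : ℝ) ≤ 1 → ∀ (y₀ : Cell 2 × ℤ) (r' n' : ℝ), r' < n' → ∀ χ : Cell 2 → ℤ → E3,
      IsTruncHarmonicZ ϱ a b w χ (idxBall y₀ (n' + 1)) →
        κ₀ * idxEnergy (latDiff E₀ χ) (idxBall y₀ r') ≤ 54 * kernelConst c * ((n' - r')⁻¹) ^ 2 * idxEnergy χ (idxBall y₀ (n' + ϱ / c + 1)))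
    (x₀ : Cell 2 × ℤ) {n : ℝ} (hn : 256 * (ϱ / c + 2) ≤ n) (hn3 : 2 ^ 25 * (ϱ / c) ≤ n ^ 3) {ψ : Cell 2 → ℤ → E3}
    (hψ : IsTruncHarmonicZ ϱ a b w ψ (idxBall x₀ n)) {E : Cell 2 × ℤ} (hE : E.2 = 0) (hE1 : (idxNorm E : ℝ) ≤ 1) (γ : Cell 2) (k : ℤ)
    (hX : (γ, k) ∈ idxBall x₀ (n / 2)) :
    n ^ 2 * ((idxBall x₀ n).ncard : ℝ) * ‖latDiff E ψ γ (k + 1) - latDiff E ψ γ k‖ ^ 2 ≤ gradConst c κ₀ ε * idxEnergy ψ (idxBall x₀ n) := by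
  have hϱc : 0 ≤ ϱ / c := div_nonneg hϱ hc.le
  have hn1 : 1 ≤ n := by linarith
  have hn0 : 0 < n := by linarith
  have hF := kernelConst_nonneg hc
  have hKK : 0 ≤ 54 * kernelConst c / κ₀ := by positivity
  have hdist : dist (γ, k) x₀ ≤ n / 2 := hX
  -- the ball about `(γ,k)`
  have hψX : IsTruncHarmonicZ ϱ a b w ψ (idxBall (γ, k) (n / 2)) := isTruncHarmonicZ_mono hψ (idxBall_subset_of_dist (by linarith))
  have hEX : idxEnergy ψ (idxBall (γ, k) (n / 2)) ≤ idxEnergy ψ (idxBall x₀ n) := idxEnergy_le_of_dist ψ (by linarith)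
  have hn2 : 16 * (ϱ / c + 2) ≤ n / 2 := by linarith
  have hn4 : 64 * (ϱ / c + 2) ≤ n / 4 := by linarith
  -- the four harmonic fields on `idxBall (γ,k) (n/4)`
  have hχ₀ := isTruncHarmonicZ_latDiff zero_le_one hE hE1 hψX
  have hχ₁ := isTruncHarmonicZ_latDiff zero_le_one idxAxis₁_snd idxNorm_idxAxis₁_le hχ₀
  have hχ₂ := isTruncHarmonicZ_latDiff zero_le_one idxAxis₂_snd idxNorm_idxAxis₂_le hχ₀
  have hχ₁₂ := isTruncHarmonicZ_latDiff zero_le_one idxAxis₁_snd idxNorm_idxAxis₁_le hχ₂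
  have g0 : IsTruncHarmonicZ ϱ a b w (latDiff E ψ) (idxBall (γ, k) (n / 4)) := isTruncHarmonicZ_mono hχ₀ (idxBall_mono _ (by linarith))
  have g1 : IsTruncHarmonicZ ϱ a b w (latDiff idxAxis₁ (latDiff E ψ)) (idxBall (γ, k) (n / 4)) :=
    isTruncHarmonicZ_mono hχ₁ (idxBall_mono _ (by linarith))
  have g2 : IsTruncHarmonicZ ϱ a b w (latDiff idxAxis₂ (latDiff E ψ)) (idxBall (γ, k) (n / 4)) :=
    isTruncHarmonicZ_mono hχ₂ (idxBall_mono _ (by linarith))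
  have g12 : IsTruncHarmonicZ ϱ a b w (latDiff idxAxis₁ (latDiff idxAxis₂ (latDiff E ψ))) (idxBall (γ, k) (n / 4)) :=
    isTruncHarmonicZ_mono hχ₁₂ (idxBall_mono _ (by linarith))
  -- their energies (WA iterated Caccioppoli)
  have hq : n / 2 / 2 = n / 4 := by ring
  have e0 := energy_iterate₁_le hc hκ₀ hϱ hP hE hE1 (γ, k) hn2 hψX
  have e1 := energy_iterate₂_le hc hκ₀ hϱ hP hE hE1 idxAxis₁_snd idxNorm_idxAxis₁_le (γ, k) hn2 hψX
  have e2 := energy_iterate₂_le hc hκ₀ hϱ hP hE hE1 idxAxis₂_snd idxNorm_idxAxis₂_le (γ, k) hn2 hψX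
  have e12 := energy_iterate₃_le hc hκ₀ hϱ hP hE hE1 (γ, k) hn2 hψX
  rw [hq] at e0 e1 e2 e12
  have m1 := mul_le_mul_of_nonneg_left hEX hKK
  have m2 := mul_le_mul_of_nonneg_left hEX (pow_nonneg hKK 2)
  have m3 := mul_le_mul_of_nonneg_left hEX (pow_nonneg hKK 3)
  have f0 : n ^ 2 * idxEnergy (latDiff E ψ) (idxBall (γ, k) (n / 4)) ≤ 2 ^ 10 * (54 * kernelConst c / κ₀) * idxEnergy ψ (idxBall x₀ n) := by
    linarith
  have f1 : n ^ 4 * idxEnergy (latDiff idxAxis₁ (latDiff E ψ)) (idxBall (γ, k) (n / 4)) ≤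
      2 ^ 20 * (54 * kernelConst c / κ₀) ^ 2 * idxEnergy ψ (idxBall x₀ n) := by linarith
  have f2 : n ^ 4 * idxEnergy (latDiff idxAxis₂ (latDiff E ψ)) (idxBall (γ, k) (n / 4)) ≤
      2 ^ 20 * (54 * kernelConst c / κ₀) ^ 2 * idxEnergy ψ (idxBall x₀ n) := by linarith
  have f12 : n ^ 6 * idxEnergy (latDiff idxAxis₁ (latDiff idxAxis₂ (latDiff E ψ))) (idxBall (γ, k) (n / 4)) ≤
      2 ^ 30 * (54 * kernelConst c / κ₀) ^ 3 * idxEnergy ψ (idxBall x₀ n) := by linarith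
  -- the long window
  set R : ℕ := ⌊n / 64⌋₊ with hRdef
  have hRle : (R : ℝ) ≤ n / 64 := Nat.floor_le (by positivity)
  have hRgt : n / 64 < (R : ℝ) + 1 := Nat.lt_floor_add_one _
  have hR1 : n / 64 ≤ 2 * (R : ℝ) + 1 := by linarith [(Nat.cast_nonneg R : (0 : ℝ) ≤ R)]
  have hR2 : 2 * (R : ℝ) + 1 ≤ n / 16 := by linarith
  have hR3 : n / 64 ≤ (R : ℝ) + 2 := by linarith
  have hQ : ∀ Y : Cell 2 × ℤ, idxNorm (Y - (γ, k)) ≤ R + ⌊ϱ / c⌋₊ + 1 → Y ∈ idxBall (γ, k) (n / 4 / 8) := by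
    intro Y hY
    show dist Y (γ, k) ≤ n / 4 / 8
    rw [dist_comm, dist_eq_idxNorm]
    have h1 : ((idxNorm (Y - (γ, k)) : ℕ) : ℝ) ≤ ((R + ⌊ϱ / c⌋₊ + 1 : ℕ) : ℝ) := by exact_mod_cast hY
    have hr' : ((⌊ϱ / c⌋₊ : ℕ) : ℝ) ≤ ϱ / c := Nat.floor_le hϱc
    push_cast at h1
    linarith
  -- WI ×4
  have w0 := single_gap_sq_le hc hL hκ₀ hϱ hε hK hT hP (γ, k) hn4 g0 γ k R hQ
  have w1 := single_gap_sq_le hc hL hκ₀ hϱ hε hK hT hP (γ, k) hn4 g1 γ k R hQ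
  have w2 := single_gap_sq_le hc hL hκ₀ hϱ hε hK hT hP (γ, k) hn4 g2 γ k R hQ
  have w12 := single_gap_sq_le hc hL hκ₀ hϱ hε hK hT hP (γ, k) hn4 g12 γ k R hQ
  -- the bracket
  have hcard := card_layerSq_le γ k (R : ℝ)
  simp only [Nat.floor_natCast] at hcard
  push_cast at hcard
  have hNc0 := ncard_idxBall_pos (γ, k) (by positivity : (0 : ℝ) ≤ n / 4)
  have hNc := cube_le_ncard_idxBall (γ, k) (by positivity : (0 : ℝ) ≤ n / 4)
  have hb := bracket_mul_le c κ₀ ε hϱc hn0 hR1 hR2 hR3 hcard hNc0 hNc hn3 (zero_le_one.trans (one_le_lipConst hc hκ₀))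
    (divConst_nonneg hc hκ₀)
  -- the layer sup bound, rewritten as gap sums
  have hsup := layer_sup_sq_le (latDiff idxAxis₃ (latDiff E ψ)) γ k (Nat.cast_nonneg R) (X := (γ, k))
    (mem_idxBallF.mpr (by rw [dist_self]; positivity)) rfl
  simp only [Nat.floor_natCast] at hsup
  push_cast at hsup
  have hLk : ∀ Y ∈ {Y ∈ idxBallF (γ, k) (R : ℝ) | Y.2 = k}, Y.2 = k := fun Y hY => (mem_filter.mp hY).2
  have c1 : latDiff idxAxis₁ (latDiff idxAxis₃ (latDiff E ψ)) = latDiff idxAxis₃ (latDiff idxAxis₁ (latDiff E ψ)) := latDiff_latDiff_comm _ _ _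
  have c2 : latDiff idxAxis₂ (latDiff idxAxis₃ (latDiff E ψ)) = latDiff idxAxis₃ (latDiff idxAxis₂ (latDiff E ψ)) := latDiff_latDiff_comm _ _ _
  have c12 : latDiff idxAxis₁ (latDiff idxAxis₃ (latDiff idxAxis₂ (latDiff E ψ))) =
      latDiff idxAxis₃ (latDiff idxAxis₁ (latDiff idxAxis₂ (latDiff E ψ))) := latDiff_latDiff_comm _ _ _
  rw [c1, c2, c12, sum_layer_axis₃_eq (latDiff E ψ) _ k hLk, sum_layer_axis₃_eq (latDiff idxAxis₁ (latDiff E ψ)) _ k hLk,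
    sum_layer_axis₃_eq (latDiff idxAxis₂ (latDiff E ψ)) _ k hLk, sum_layer_axis₃_eq (latDiff idxAxis₁ (latDiff idxAxis₂ (latDiff E ψ))) _ k hLk,
    latDiff_axis₃_apply] at hsup
  -- assemble
  have hgb : 0 ≤ gradBrk c κ₀ ε := by
    have h1 := one_le_lipConst hc hκ₀
    have h2 := divConst_nonneg hc hκ₀
    rw [gradBrk]; positivity
  have hmain := gap_algebra hn0 (Nat.cast_nonneg R) hR1 hR2 (sq_nonneg _) (sum_nonneg fun _ _ => sq_nonneg _) (sum_nonneg fun _ _ => sq_nonneg _)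
    (sum_nonneg fun _ _ => sq_nonneg _) (idxEnergy_nonneg _ _) (idxEnergy_nonneg _ _) (idxEnergy_nonneg _ _) (idxEnergy_nonneg _ _)
    (sq_nonneg (modeConst c (κ₀ - ε / 2))) hgb hb w0 w1 w2 w12 f0 f1 f2 f12 hsup
  have hNcn := ncard_idxBall_le_cube x₀ hn1
  calc n ^ 2 * ((idxBall x₀ n).ncard : ℝ) * ‖latDiff E ψ γ (k + 1) - latDiff E ψ γ k‖ ^ 2
      ≤ n ^ 2 * (27 * n ^ 3) * ‖latDiff E ψ γ (k + 1) - latDiff E ψ γ k‖ ^ 2 :=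
        mul_le_mul_of_nonneg_right (mul_le_mul_of_nonneg_left hNcn (sq_nonneg n)) (sq_nonneg _)
    _ = 27 * (n ^ 5 * ‖latDiff E ψ γ (k + 1) - latDiff E ψ γ k‖ ^ 2) := by ring
    _ ≤ 27 * (modeConst c (κ₀ - ε / 2) ^ 2 * gradBrk c κ₀ ε *
          (2 ^ 26 * (54 * kernelConst c / κ₀) + 2 ^ 29 * (54 * kernelConst c / κ₀) ^ 2 + 2 ^ 30 * (54 * kernelConst c / κ₀) ^ 3) *
          idxEnergy ψ (idxBall x₀ n)) := by linarith
    _ = gradConst c κ₀ ε * idxEnergy ψ (idxBall x₀ n) := by rw [gradConst]; ring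

/-! ### WK.5  The closed statement of this part -/

/-- The content of part WK as one closed proposition: the pointwise in-plane gradient bound of the vertical gap increment of a harmonic field,
with a `ϱ`-free constant. -/
def GapGradientShape : Prop :=
  ∀ c : ℝ, 0 < c → ∀ (a b : E3) (w : ℤ → E3), IsLayeredCrystal c a b w → ∀ κ₀ ε ϱ : ℝ, 0 < κ₀ → 0 ≤ ϱ → ε < 2 * κ₀ →
    CoerciveZ (layeredKernel a b w) κ₀ →
    (∀ φ : Cell 2 → ℤ → E3, HasFiniteSupport φ → Summable (tailFam ϱ a b w φ) ∧ ∑' x, tailFam ϱ a b w φ x ≤ ε * nnFormZ φ) →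
    (∀ E₀ : Cell 2 × ℤ, E₀.2 = 0 → (idxNorm E₀ : ℝ) ≤ 1 → ∀ (y₀ : Cell 2 × ℤ) (r' n' : ℝ), r' < n' → ∀ χ : Cell 2 → ℤ → E3,
      IsTruncHarmonicZ ϱ a b w χ (idxBall y₀ (n' + 1)) →
        κ₀ * idxEnergy (latDiff E₀ χ) (idxBall y₀ r') ≤ 54 * kernelConst c * ((n' - r')⁻¹) ^ 2 * idxEnergy χ (idxBall y₀ (n' + ϱ / c + 1))) →
    ∀ (x₀ : Cell 2 × ℤ) (n : ℝ), 256 * (ϱ / c + 2) ≤ n → 2 ^ 25 * (ϱ / c) ≤ n ^ 3 → ∀ ψ : Cell 2 → ℤ → E3,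
      IsTruncHarmonicZ ϱ a b w ψ (idxBall x₀ n) → ∀ E : Cell 2 × ℤ, E.2 = 0 → (idxNorm E : ℝ) ≤ 1 → ∀ (γ : Cell 2) (k : ℤ),
        (γ, k) ∈ idxBall x₀ (n / 2) →
          n ^ 2 * ((idxBall x₀ n).ncard : ℝ) * ‖latDiff E ψ γ (k + 1) - latDiff E ψ γ k‖ ^ 2 ≤ gradConst c κ₀ ε * idxEnergy ψ (idxBall x₀ n)

/-- WK holds. [this file, g58] -/
theorem gapGradientShape_holds : GapGradientShape :=
  fun _c hc _a _b _w hL _κ₀ _ε _ϱ hκ₀ hϱ hε hK hT hP x₀ _n hn hn3 _ψ hψ _E hE hE1 γ k hX =>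
    gap_gradient_sq_le hc hL hκ₀ hϱ hε hK hT hP x₀ hn hn3 hψ hE hE1 γ k hX

end GapGradient

end Summit.AtomisticToContinuum.Crystallization.Theorems.ChartedZeroExcessLayeredLatticeLiouville
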